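import Summits.MatrixMultiplication.MatrixMultiplication.Theses.IrreducibleSublevelSets
import Literature.Computability.AlgebraicComplexity.AsymptoticRankLimit
import Literature.Computability.AlgebraicComplexity.PrattTripartitionBoundsProofs

/-!
# `FewAsymptoticRanks`: the bound `abc + 1` is attained in the smallest formats

Crux `IrreducibleSublevelSets.FewAsymptoticRanks` (stmt-MatrixMultiplication-19019), refuter lane
(`Theorems/FewAsymptoticRanks/Negative/`; crux-attack at birth, 2026-08-17).  Tightness / boundary
facts for the prover and the planner; no theorem here asserts a Theses decl positively.

* `encard_range_asymptoticRank_fin0` — a format with `a = 0` carries exactly one tensor, so the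
  value set of `R̃` is a singleton: `encard = 1 = 0·b·c + 1` (bound attained).
* `asymptoticRank_scalar` — `R̃(x) = 1` for a non-zero scalar `x` (format `1 × 1 × 1`).
* `range_asymptoticRank_fin1` — in format `1 × 1 × 1` the value set is exactly `{0, 1}`, so
  `encard = 2 = 1·1·1 + 1` (`encard_range_asymptoticRank_fin1`, bound attained again).
* `fewAsymptoticRanks_false_without_addOne` (`…_fin0`) — the natural strengthening that drops
  the `+ 1` (the literal printed sentence of Christandl–Hoeberechts–Nieuwboer–Vrana–Zuiddam,
  arXiv:2411.15789 §5 p. 14: "at most `d₁⋯d_k` asymptotic ranks in format `d₁ × ⋯ × d_k`", read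
  with the zero tensor's value `0` counted) is FALSE at `1 × 1 × 1` (and at `abc = 0`).  The
  item's `+ 1` (a chain of `abc + 1` closed irreducible sets has `abc` strict inclusions) is
  therefore load-bearing, not slack.
-/

namespace Summit.MatrixMultiplication.MatrixMultiplication.Theorems.FewAsymptoticRanks.Negative

open Literature.Computability.AlgebraicComplexity
open Summit.MatrixMultiplication.MatrixMultiplication.Theses.IrreducibleSublevelSets

/-- Read-back: the crux unfolds, by `Iff.rfl`, to the verbatim body below. -/
theorem crux_iff : FewAsymptoticRanks ↔
    ∀ a b c : ℕ, (Set.range fun T : Fin a → Fin b → Fin c → ℂ =>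
      asymptoticRank T).encard ≤ (a * b * c + 1 : ℕ) := Iff.rfl

/-- `a = 0`: the format has exactly one tensor, the value set of `R̃` is a singleton and
`encard = 1 = 0·b·c + 1` — the bound of `FewAsymptoticRanks` is attained. -/
theorem encard_range_asymptoticRank_fin0 (b c : ℕ) :
    (Set.range fun T : Fin 0 → Fin b → Fin c → ℂ => asymptoticRank T).encard
      = (0 * b * c + 1 : ℕ) := by
  have h : (Set.range fun T : Fin 0 → Fin b → Fin c → ℂ => asymptoticRank T) =
      {asymptoticRank (fun (_ : Fin 0) (_ : Fin b) (_ : Fin c) => (0 : ℂ))} := by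
    ext r
    simp only [Set.mem_range, Set.mem_singleton_iff]
    constructor
    · rintro ⟨T, rfl⟩
      have : T = fun (_ : Fin 0) (_ : Fin b) (_ : Fin c) => (0 : ℂ) := by
        funext i; exact Fin.elim0 i
      rw [this]
    · rintro rfl; exact ⟨_, rfl⟩
  rw [h, Set.encard_singleton]
  simp

/-- The asymptotic rank of a non-zero scalar (format `1 × 1 × 1`) is `1`: `R̃ ≤ R ≤ 1·1·1`, and
every Kronecker power has the non-zero entry `x^(N+1)`, hence rank `≥ 1`. -/
theorem asymptoticRank_scalar {x : ℂ} (hx : x ≠ 0) :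
    asymptoticRank (fun (_ : Fin 1) (_ : Fin 1) (_ : Fin 1) => x) = 1 := by
  apply le_antisymm
  · calc asymptoticRank (fun (_ : Fin 1) (_ : Fin 1) (_ : Fin 1) => x)
        ≤ (tensorRank (fun (_ : Fin 1) (_ : Fin 1) (_ : Fin 1) => x) : ℝ) :=
          asymptoticRank_le_tensorRank _
      _ ≤ 1 := by
          have := tensorRank_le_card (fun (_ : Fin 1) (_ : Fin 1) (_ : Fin 1) => x)
          simp only [Fintype.card_fin, mul_one] at this
          exact_mod_cast this
  · unfold asymptoticRank
    apply le_ciInf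
    intro N
    have h1 : 1 ≤ tensorRank (kroneckerPow (fun (_ : Fin 1) (_ : Fin 1) (_ : Fin 1) => x) (N + 1)) :=
      one_le_tensorRank_of_apply_ne_zero (a := fun _ => 0) (b := fun _ => 0) (c := fun _ => 0)
        (by simp [kroneckerPow_apply, hx])
    have h1' : (1 : ℝ) ≤
        (tensorRank (kroneckerPow (fun (_ : Fin 1) (_ : Fin 1) (_ : Fin 1) => x) (N + 1)) : ℝ) := by
      exact_mod_cast h1
    calc (1 : ℝ) = 1 ^ ((N : ℝ) + 1)⁻¹ := by simp
      _ ≤ _ := Real.rpow_le_rpow (by norm_num) h1' (by positivity)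

/-- Format `1 × 1 × 1`: the value set of `R̃` is exactly `{0, 1}`. -/
theorem range_asymptoticRank_fin1 :
    (Set.range fun T : Fin 1 → Fin 1 → Fin 1 → ℂ => asymptoticRank T) = {0, 1} := by
  ext r
  simp only [Set.mem_range, Set.mem_insert_iff, Set.mem_singleton_iff]
  constructor
  · rintro ⟨T, rfl⟩
    by_cases hT : T 0 0 0 = 0
    · left
      have : T = 0 := by
        funext i j k
        rw [Subsingleton.elim i 0, Subsingleton.elim j 0, Subsingleton.elim k 0]; exact hT
      rw [this]; exact asymptoticRank_zero
    · right
      have : T = fun _ _ _ => T 0 0 0 := by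
        funext i j k
        rw [Subsingleton.elim i 0, Subsingleton.elim j 0, Subsingleton.elim k 0]
      rw [this]; exact asymptoticRank_scalar hT
  · rintro (rfl | rfl)
    · exact ⟨0, asymptoticRank_zero⟩
    · exact ⟨fun _ _ _ => 1, asymptoticRank_scalar one_ne_zero⟩

/-- TIGHTNESS at `1 × 1 × 1`: `encard = 2 = 1·1·1 + 1`, the bound of `FewAsymptoticRanks` is
attained. -/
theorem encard_range_asymptoticRank_fin1 :
    (Set.range fun T : Fin 1 → Fin 1 → Fin 1 → ℂ => asymptoticRank T).encard
      = (1 * 1 * 1 + 1 : ℕ) := by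
  rw [range_asymptoticRank_fin1, Set.encard_pair zero_ne_one]
  simp

/-- ANY PROOF MUST USE the `+ 1`.  The crux with the `+ 1` dropped (verbatim otherwise) is the
literal printed sentence "at most `d₁⋯d_k` asymptotic ranks in format `d₁ × ⋯ × d_k`" with the
value `0` counted; it fails at format `1 × 1 × 1` (values `0` and `1`, two of them, `> 1·1·1`),
and also at every format with `abc = 0` (one value, `> 0`). -/
theorem fewAsymptoticRanks_false_without_addOne :
    ¬ ∀ a b c : ℕ, (Set.range fun T : Fin a → Fin b → Fin c → ℂ =>
        asymptoticRank T).encard ≤ (a * b * c : ℕ) := by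
  intro h
  have h1 := h 1 1 1
  rw [encard_range_asymptoticRank_fin1] at h1
  norm_num at h1

/-- The same failure at the empty formats: with `a = 0` the single value already exceeds
`0·b·c = 0`. -/
theorem fewAsymptoticRanks_false_without_addOne_fin0 (b c : ℕ) :
    ¬ (Set.range fun T : Fin 0 → Fin b → Fin c → ℂ => asymptoticRank T).encard ≤ (0 * b * c : ℕ) := by
  rw [encard_range_asymptoticRank_fin0]
  norm_num

end Summit.MatrixMultiplication.MatrixMultiplication.Theorems.FewAsymptoticRanks.Negative
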